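import Mathlib
import Summits.HubbardSuperconductivity.HubbardSuperconductivity.Theorems.KLProgrammeH10TwoPointLimitSectorCount2nShell
import HarnessLib

/-!
# Route KLProgramme — crux K1 `H10TwoPointLimit`: the `2n`-leg sector count on THICK and PERTURBED shells
(exact conservation; the citable forms)

Helper for stub `stub_H10_mu_of_count : CountPairsOffset → H10AnalysisWindow` of the registered skeleton of K1
(stmt-HubbardSuperconductivity-19938); AUDIT-A1A2 §2 row 2.12 (a)/(b) and GAP-LEDGER G-002 at EVERY leg number
(the four-leg forms are `klsc_fourSectorCount_thickShell` / `_of_subset_shell` / `_perturbed` of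
`KLProgrammeSectorCountShellInclusion.lean`). Instances of the master count
`h10_twoNSectorCount_subset_of_countPairsOffset` (`KLProgrammeH10TwoPointLimitSectorCount2nShell.lean`) at
conservation slack `s = 0`, i.e. exact conservation `Σ k = 2πG` as in `h10_twoNSectorCount_of_countPairsOffset`:

* `h10_twoNSectorCount_constrained_of_countPairsOffset` — arbitrary per-leg constraints implying the thick free
  shell `|ε - μ| ≤ c·w` (`w = π/2ⁿ`, any real `c`), e.g. the supports of scale-`h` sector propagators;
* `h10_twoNSectorCount_thick_of_countPairsOffset` — (a) the thick shell itself;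
* `h10_twoNSectorCount_perturbed_of_countPairsOffset` — (b) per-leg PERTURBED dispersions `ε'` with
  `sup_square |ε' - ε| ≤ δ` and shells `|ε' - μ| ≤ t`, `t + δ ≤ c·w`: the moving Fermi curve of the scale-`h`
  dispersion (Benfatto–Giuliani–Mastropietro 2006 (2.36): `sup |ε_h - ε| ≤ C|U||h|γ^{2h} ≪ γ^h`) costs nothing.

All conditional on the route's support item `CountPairsOffset` (stmt-HubbardSuperconductivity-20036); unconditional
by application to its proof once that item is closed.
-/

open Classical

noncomputable section

-- the tree's namespace `Summit.<Summit>.<Problem>.Theorems` repeats the summit name by design (D-0017)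
set_option linter.dupNamespace false

open Real Set Literature.MathematicalPhysics.QuantumLattice Literature.MathematicalPhysics.QuantumLattice.BandSectorCounting

namespace Summit.HubbardSuperconductivity.HubbardSuperconductivity.Theorems

/-- **The `2n`-leg sector count under arbitrary leg constraints inside the thick shell, exact conservation**
(from `CountPairsOffset`): for every window `[μ₁, μ₂] ⊂ (-4, 0)`, every `m` and every real `c` there is `K` such
that for ALL per-leg constraints on momenta of the open square implying `|ε(k) - μ| ≤ c·π/2ⁿ`, the number of
sector triples admitting constrained momenta in the prescribed sectors with `Σ k = 2πG` is `≤ K·2ⁿ·(n+1)` —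
the shape of `h10_twoNSectorCount_of_countPairsOffset` with the shell replaced by any leg supports inside a thick
free shell (the case `s = 0` of `h10_twoNSectorCount_subset_of_countPairsOffset`). -/
theorem h10_twoNSectorCount_constrained_of_countPairsOffset
    (hC : Summit.HubbardSuperconductivity.HubbardSuperconductivity.Theses.KLProgramme.CountPairsOffset) :
    ∀ μ₁ μ₂ : ℝ, -4 < μ₁ → μ₁ ≤ μ₂ → μ₂ < 0 → ∀ (m : ℕ) (c : ℝ), ∃ K : ℝ, 0 < K ∧
      ∀ μ ∈ Set.Icc μ₁ μ₂, ∀ (n : ℕ) (G : Fin 2 → ℤ) (ωf : Fin m → ℕ)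
        (Sf : Fin m → (Fin 2 → ℝ) → Prop) (S : Fin 3 → (Fin 2 → ℝ) → Prop),
        (∀ j k, (∀ i, |k i| < Real.pi) → Sf j k → |sqDispersion k - μ| ≤ c * sectorWidth n) →
        (∀ l k, (∀ i, |k i| < Real.pi) → S l k → |sqDispersion k - μ| ≤ c * sectorWidth n) →
        (((Finset.univ : Finset (Fin (sectorCount n) × Fin (sectorCount n) × Fin (sectorCount n))).filter
          (fun ω : Fin (sectorCount n) × Fin (sectorCount n) × Fin (sectorCount n) =>
            ∃ (kf : Fin m → Fin 2 → ℝ) (k : Fin 3 → Fin 2 → ℝ),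
            (∀ j i, |kf j i| < Real.pi) ∧ (∀ l i, |k l i| < Real.pi) ∧
            (∀ j, Sf j (kf j)) ∧ (∀ l, S l (k l)) ∧
            (∀ j, sectorIndex n (Complex.arg (⟨kf j 0, kf j 1⟩ : ℂ)) = ωf j) ∧
            sectorIndex n (Complex.arg (⟨k 0 0, k 0 1⟩ : ℂ)) = (ω.1 : ℕ) ∧
            sectorIndex n (Complex.arg (⟨k 1 0, k 1 1⟩ : ℂ)) = (ω.2.1 : ℕ) ∧
            sectorIndex n (Complex.arg (⟨k 2 0, k 2 1⟩ : ℂ)) = (ω.2.2 : ℕ) ∧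
            (∀ i, (∑ j, kf j i) + (∑ l, k l i) = 2 * Real.pi * (G i : ℝ)))).card : ℝ) ≤
          K * 2 ^ n * ((n : ℝ) + 1) := by
  intro μ₁ μ₂ hμ₁ h12 hμ₂ m c
  obtain ⟨K, hK, H⟩ := h10_twoNSectorCount_subset_of_countPairsOffset hC μ₁ μ₂ hμ₁ h12 hμ₂ m c 0
  refine ⟨K, hK, fun μ hμ n G ωf Sf S hSf hS => le_trans ?_ (H μ hμ n G ωf Sf S hSf hS)⟩
  refine Nat.cast_le.2 (Finset.card_le_card fun ω hω => ?_)
  rw [Finset.mem_filter] at hω ⊢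
  obtain ⟨-, kf, k, hkf, hk, hshf, hsh, hif, hi0, hi1, hi2, hsum⟩ := hω
  refine ⟨Finset.mem_univ _, kf, k, hkf, hk, hshf, hsh, hif, hi0, hi1, hi2, fun i => ?_⟩
  rw [hsum i, sub_self, abs_zero, zero_mul]

/-- **(a) The `2n`-leg sector count on the THICK shell `|ε - μ| ≤ c·w`** (`w = π/2ⁿ` the sector width, `c` any
real; from `CountPairsOffset`): `≤ K·2ⁿ·(n+1)` sector triples, `K = K(μ₁, μ₂, m, c)` — AUDIT-A1A2 §2 row 2.12 (a)
at every leg number (Benfatto–Giuliani–Mastropietro 2006 Lemma 3.1 / App. A2, whose isotropic shell `γ^h e₀` is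
a fixed multiple of, not equal to, the angular width). The case `c = 1` is `h10_twoNSectorCount_of_countPairsOffset`;
four legs: `klsc_fourSectorCount_thickShell`. -/
theorem h10_twoNSectorCount_thick_of_countPairsOffset
    (hC : Summit.HubbardSuperconductivity.HubbardSuperconductivity.Theses.KLProgramme.CountPairsOffset) :
    ∀ μ₁ μ₂ : ℝ, -4 < μ₁ → μ₁ ≤ μ₂ → μ₂ < 0 → ∀ (m : ℕ) (c : ℝ), ∃ K : ℝ, 0 < K ∧
      ∀ μ ∈ Set.Icc μ₁ μ₂, ∀ (n : ℕ) (G : Fin 2 → ℤ) (ωf : Fin m → ℕ),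
        (((Finset.univ : Finset (Fin (sectorCount n) × Fin (sectorCount n) × Fin (sectorCount n))).filter
          (fun ω : Fin (sectorCount n) × Fin (sectorCount n) × Fin (sectorCount n) =>
            ∃ (kf : Fin m → Fin 2 → ℝ) (k : Fin 3 → Fin 2 → ℝ),
            (∀ j i, |kf j i| < Real.pi) ∧ (∀ l i, |k l i| < Real.pi) ∧
            (∀ j, |sqDispersion (kf j) - μ| ≤ c * sectorWidth n) ∧
            (∀ l, |sqDispersion (k l) - μ| ≤ c * sectorWidth n) ∧
            (∀ j, sectorIndex n (Complex.arg (⟨kf j 0, kf j 1⟩ : ℂ)) = ωf j) ∧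
            sectorIndex n (Complex.arg (⟨k 0 0, k 0 1⟩ : ℂ)) = (ω.1 : ℕ) ∧
            sectorIndex n (Complex.arg (⟨k 1 0, k 1 1⟩ : ℂ)) = (ω.2.1 : ℕ) ∧
            sectorIndex n (Complex.arg (⟨k 2 0, k 2 1⟩ : ℂ)) = (ω.2.2 : ℕ) ∧
            (∀ i, (∑ j, kf j i) + (∑ l, k l i) = 2 * Real.pi * (G i : ℝ)))).card : ℝ) ≤
          K * 2 ^ n * ((n : ℝ) + 1) := by
  intro μ₁ μ₂ hμ₁ h12 hμ₂ m c
  obtain ⟨K, hK, H⟩ := h10_twoNSectorCount_constrained_of_countPairsOffset hC μ₁ μ₂ hμ₁ h12 hμ₂ m c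
  refine ⟨K, hK, fun μ hμ n G ωf => ?_⟩
  exact H μ hμ n G ωf (fun _ k => |sqDispersion k - μ| ≤ c * sectorWidth n)
    (fun _ k => |sqDispersion k - μ| ≤ c * sectorWidth n) (fun _ _ _ h => h) (fun _ _ _ h => h)

/-- **(b) The `2n`-leg sector count for PERTURBED dispersions** (from `CountPairsOffset`): for every window,
every `m` and every real `c` there is `K` such that for all per-leg dispersions `ε'_j`, `ε'_l` on the open square
with `sup |ε' - ε| ≤ δ` and every shell thickness `t` with `t + δ ≤ c·w` (`w = π/2ⁿ`), the number of sector
triples admitting momenta of the `ε'`-shells `|ε'(k) - μ| ≤ t` in the prescribed sectors with `Σ k = 2πG` is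
`≤ K·2ⁿ·(n+1)`, uniformly in `ε'`, `t`, `δ`, `G`, the fixed sectors and `μ ∈ [μ₁, μ₂]` — AUDIT-A1A2 §2 row 2.12 (b)
/ GAP-LEDGER G-002 at every leg number: Lemma 3.1 / App. A2 of Benfatto–Giuliani–Mastropietro 2006 for the
moving Fermi curve of the scale-`h` dispersion `ε_h` ((2.36): `sup |ε_h - ε| ≤ C|U||h|γ^{2h}`), by
`{|ε' - μ| ≤ t} ⊆ {|ε - μ| ≤ t + δ} ⊆ {|ε - μ| ≤ c·w}`. Four legs: `klsc_fourSectorCount_perturbed`. -/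
theorem h10_twoNSectorCount_perturbed_of_countPairsOffset
    (hC : Summit.HubbardSuperconductivity.HubbardSuperconductivity.Theses.KLProgramme.CountPairsOffset) :
    ∀ μ₁ μ₂ : ℝ, -4 < μ₁ → μ₁ ≤ μ₂ → μ₂ < 0 → ∀ (m : ℕ) (c : ℝ), ∃ K : ℝ, 0 < K ∧
      ∀ μ ∈ Set.Icc μ₁ μ₂, ∀ (n : ℕ) (G : Fin 2 → ℤ) (ωf : Fin m → ℕ)
        (εf : Fin m → (Fin 2 → ℝ) → ℝ) (ε' : Fin 3 → (Fin 2 → ℝ) → ℝ) (t δ : ℝ),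
        (∀ j k, (∀ i, |k i| < Real.pi) → |εf j k - sqDispersion k| ≤ δ) →
        (∀ l k, (∀ i, |k i| < Real.pi) → |ε' l k - sqDispersion k| ≤ δ) →
        t + δ ≤ c * sectorWidth n →
        (((Finset.univ : Finset (Fin (sectorCount n) × Fin (sectorCount n) × Fin (sectorCount n))).filter
          (fun ω : Fin (sectorCount n) × Fin (sectorCount n) × Fin (sectorCount n) =>
            ∃ (kf : Fin m → Fin 2 → ℝ) (k : Fin 3 → Fin 2 → ℝ),
            (∀ j i, |kf j i| < Real.pi) ∧ (∀ l i, |k l i| < Real.pi) ∧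
            (∀ j, |εf j (kf j) - μ| ≤ t) ∧ (∀ l, |ε' l (k l) - μ| ≤ t) ∧
            (∀ j, sectorIndex n (Complex.arg (⟨kf j 0, kf j 1⟩ : ℂ)) = ωf j) ∧
            sectorIndex n (Complex.arg (⟨k 0 0, k 0 1⟩ : ℂ)) = (ω.1 : ℕ) ∧
            sectorIndex n (Complex.arg (⟨k 1 0, k 1 1⟩ : ℂ)) = (ω.2.1 : ℕ) ∧
            sectorIndex n (Complex.arg (⟨k 2 0, k 2 1⟩ : ℂ)) = (ω.2.2 : ℕ) ∧
            (∀ i, (∑ j, kf j i) + (∑ l, k l i) = 2 * Real.pi * (G i : ℝ)))).card : ℝ) ≤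
          K * 2 ^ n * ((n : ℝ) + 1) := by
  intro μ₁ μ₂ hμ₁ h12 hμ₂ m c
  obtain ⟨K, hK, H⟩ := h10_twoNSectorCount_constrained_of_countPairsOffset hC μ₁ μ₂ hμ₁ h12 hμ₂ m c
  refine ⟨K, hK, fun μ hμ n G ωf εf ε' t δ hεf hε' htδ => ?_⟩
  have key : ∀ (e : (Fin 2 → ℝ) → ℝ) (k : Fin 2 → ℝ), |e k - sqDispersion k| ≤ δ → |e k - μ| ≤ t →
      |sqDispersion k - μ| ≤ c * sectorWidth n := by
    intro e k h1 h2
    calc |sqDispersion k - μ| = |(e k - μ) - (e k - sqDispersion k)| := by ring_nf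
      _ ≤ |e k - μ| + |e k - sqDispersion k| := abs_sub _ _
      _ ≤ t + δ := add_le_add h2 h1
      _ ≤ c * sectorWidth n := htδ
  exact H μ hμ n G ωf (fun j k => |εf j k - μ| ≤ t) (fun l k => |ε' l k - μ| ≤ t)
    (fun j k hk h => key (εf j) k (hεf j k hk) h) (fun l k hk h => key (ε' l) k (hε' l k hk) h)

end Summit.HubbardSuperconductivity.HubbardSuperconductivity.Theorems

end
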